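import Summits.BirchSwinnertonDyer.BirchSwinnertonDyer.Theorems.GenusKolyvaginAtTwoPowDvdShaCardAtTwoRTRankDescentRankLeOne
import Literature.NumberTheory.EllipticCurves.ShaCorestrictionIndexTwo
import Literature.NumberTheory.EllipticCurves.BSDRankZeroDensityProofs
import Summits.BirchSwinnertonDyer.BirchSwinnertonDyer.Theorems.GenusKolyvaginAtTwoShaCardDvdPowAtTwoRTInvariantClassesDescend
import HarnessLib

/-!
# Route `GenusKolyvaginAtTwo`, crux U_T `ShaCardDvdPowAtTwoRT` (stmt-BirchSwinnertonDyer-23658), LINE 19 `rational_pair_descent`,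
# stub SANDWICH′: THE KRAMER CLASS IS NON-ZERO (`ker(H¹(ℚ, E) → H¹(K, E_K)) ≠ 0`) AND τ-INVARIANT CLASSES OF `H¹(K, E_K)` ARE
# RESTRICTIONS, on U_T's frame with `w(E) = 1`

Seat `bsd-line-gk2-p1` g19 (LEAD, cell `bsd-f1-sign2`), `--supports stmt-BirchSwinnertonDyer-23658` (helper; closes nothing).
THEOREMS ONLY (no definition, no named fact, no `sorry`).  BSD is NOT proved by any of this; U_T is not proved.

WHY (LEAD memo `Cruxes/ShaCardDvdPowAtTwoRT/Lines/rational-pair-descent-lead-g19.md` §1c/§6c).  The count behind `stub_sandwichOfMinimalTwin`,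
`#Ш(E/K)[2^∞] ∣ 2 · #Ш(E/ℚ)[2^∞]`, reads `#X^τ = #res⁻¹(X^τ) / #ker(res)` on the τ-fixed part; the bit `#ker(res) ≥ 2` is the Kramer class
of the generator of `E(K)/torsion` (Kramer 1981, proof of Thm. 2: `ker(res) = H¹(K/ℚ, E(K))`; on the frame `E(K) ⊗ ℚ = ℚ · y_K` is
τ-ANTI-invariant, so `H¹(C₂, E(K)) = ℤ/2 ≠ 0`); the tree had the UPPER bound `#ker ≤ 2^{rank E(K)}` (gk2-p3 g16); this is the LOWER bound.

* §1 `exists_ne_zero_resSubgroupH1_eq_zero_of_not_principal` (generic, index `2`): for `N ≤ G` open normal with `G = N ⊔ N c` and an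
  `N`-fixed `a ∈ M` with `a + c • a = 0` which is NOT of the form `c • b − b` (`b` `N`-fixed), the inflated class of `g ↦ (0 on N, a on N c)`
  is a NON-ZERO element of `ker(H¹(G, M) → H¹(N, M))` (Serre I §5.8: inflation is injective).
* §2 `exists_ne_zero_resBaseChange_eq_zero_of_point` (`E = W/ℚ`, `K` quadratic, `σ ≠ 1`): a point `P ∈ E(K)` with `σP + P = 0` and
  `P ≠ σQ − Q` for all `Q ∈ E(K)` gives a non-zero element of `ker(resBaseChange W K)` (transport through `geomPointsEquivBaseChange`,
  `IsLiftOfAut.pointsMap_toGeomPoints`, Galois descent `exists_toGeomPoints_eq_of_forall_smul_eq`, `galH1Model_resBaseChange`).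
* §3 `exists_framePackage_onHabitat` + **`exists_ne_zero_resBaseChange_eq_zero_onHabitat`**: on U_T's frame (rev 37 binders; only `hndiv` of
  the `M₀`-clause used) with `W.rootNumber = 1`: `ker(resBaseChange W K) ≠ 0`.  The point is `P = m • Q₀` where `2^(n₀) Q₀ = y_K`, `Q₀ ∉ 2E(K)`
  (as in `…RTRankDescentRankLeOne`), `m` = the (odd) order of the torsion point `τQ₀ + Q₀` (Gross 5.3 with `w = 1`); `P ≠ τQ − Q` because
  `#(E(K)/2E(K)) = 2^(rank E(K)) · #E(K)[2] ≤ 2` (gk2-p4 g21 `mordellWeilRank_baseChange_le_one_onHabitat`, `natCard_quotient_range_zsmul`),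
  so `τ` acts trivially on `E(K)/2E(K)` and every `τQ − Q` lies in `2E(K)`, while `m • Q₀ ∉ 2E(K)`.  Also **`exists_fixed_half_onHabitat`**:
  a τ-fixed point of `E(K)` is `S + S` with `S` τ-fixed (same package).
* §4 **`exists_resBaseChange_eq_of_conjH1Points_eq_onHabitat`**: on the same frame every `τ_*`-invariant class of `H¹(K, E_K)` is a restriction
  from `H¹(ℚ, E)` (this seat's `exists_resBaseChange_eq_of_conjH1Points_eq_of_twoDivisible`, p748087, fed with §3's halving).

References: [Kramer1981] proof of Thm. 2; [SerreGaloisCohomology1997] I §5.8; [GrossLMS1991] §5 Prop. 5.3; [SilvermanAEC2009] VIII.§1, X.§4.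
-/

set_option autoImplicit false
set_option linter.dupNamespace false

noncomputable section

open scoped Classical

namespace Summit.BirchSwinnertonDyer.BirchSwinnertonDyer.Theorems.GenusExact.PlusDescent

open Literature.NumberTheory.EllipticCurves Literature.NumberTheory.GaloisRepresentations WeierstrassCurve NumberField
  IsDedekindDomain Field Literature.NumberTheory.EllipticCurves.ModularForms AddSubgroup
open Summit.BirchSwinnertonDyer.BirchSwinnertonDyer.Theses.GenusKolyvaginAtTwo (KolyvaginRelationAtTwo)
open Summit.BirchSwinnertonDyer.Rank1Residual

universe u

/-! ## §1 A non-principal anti-invariant fixed element inflates to a non-zero class killed by restriction -/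

section Generic
variable {G : Type u} [Group G] [TopologicalSpace G] [IsTopologicalGroup G]
variable {N : Subgroup G} [N.Normal] {c : G}
variable {M : Type u} [AddCommGroup M] [DistribMulAction G M] [TopologicalSpace M] [DiscreteTopology M]

/-- **A non-zero inflated class in `ker(res)`.**  `N ≤ G` open normal with `G = N ⊔ N c`; `a ∈ M` fixed by `N` with `a + c • a = 0` and
NOT of the form `c • b − b` with `b` fixed by `N`.  Then the crossed homomorphism `g ↦ 0` (`g ∈ N`), `g ↦ a` (`g ∉ N`) inflates to a
class `η ≠ 0` of `H¹(G, M)` with `res η = 0` in `H¹(N, M)` (`H¹(⟨c⟩, M^N) ↪ H¹(G, M)`, Serre I §5.8).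
[cite: SerreGaloisCohomology1997, I §5.8] [cite: Kramer1981, proof of Thm. 2] -/
theorem exists_ne_zero_resSubgroupH1_eq_zero_of_not_principal (hN : IsOpen (N : Set G))
    (hc : ∀ b : G, Xor (b * c⁻¹ ∈ N) (b ∈ N)) {a : M} (haN : ∀ n : N, (n : G) • a = a) (hac : a + c • a = 0)
    (hnp : ∀ b : M, (∀ n : N, (n : G) • b = b) → a ≠ c • b - b) :
    ∃ η : discreteH1 G M, η ≠ 0 ∧ resSubgroupH1 N M η = 0 := by
  have hca : c • a = -a := eq_neg_of_add_eq_zero_right hac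
  let f : G → M := fun g ↦ if g ∈ N then 0 else a
  have hfN : ∀ n : N, f n = 0 := fun n ↦ by simp [f, n.2]
  have hfNc : ∀ n : N, f (n * c) = a := fun n ↦ by simp [f, mul_not_mem hc n]
  have hf : f ∈ cocyclesVanishingOn M N := by
    refine ⟨fun g h ↦ ?_, fun n hn ↦ by simp [f, hn]⟩
    rcases exists_eq_or_eq_mul hc g with ⟨n₁, rfl⟩ | ⟨n₁, rfl⟩ <;>
      rcases exists_eq_or_eq_mul hc h with ⟨n₂, rfl⟩ | ⟨n₂, rfl⟩
    · rw [← Subgroup.coe_mul, hfN, hfN, hfN, smul_zero, add_zero]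
    · rw [← mul_assoc, ← Subgroup.coe_mul, hfNc, hfN, hfNc, zero_add, haN]
    · have e : (n₁ : G) * c * n₂ = ((n₁ * cConj c n₂ : N) : G) * c := by
        simp only [Subgroup.coe_mul, cConj_coe, mul_assoc, inv_mul_cancel, mul_one]
      rw [e, hfNc, hfNc, hfN, smul_zero, add_zero]
    · have e : (n₁ : G) * c * (n₂ * c) = ((n₁ * cConj c n₂ * cSq hc : N) : G) := by
        simp only [Subgroup.coe_mul, cConj_coe, cSq_coe, mul_assoc, inv_mul_cancel_left]
      rw [e, hfN, hfNc, hfNc, mul_smul, hca, smul_neg, haN, add_neg_cancel]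
  refine ⟨inflClass M N hN ⟨f, hf⟩, fun hη ↦ ?_, ?_⟩
  · -- `[f] = 0`: `f g = g • m − m`; on `N`: `m` is `N`-fixed; at `c`: `a = c • m − m`
    rw [inflClass_apply, oneCocycleClass_eq_zero_iff] at hη
    obtain ⟨m, hm⟩ := hη
    have hm' : ∀ g : G, f g = g • m - m := fun g ↦ by
      have h := hm g
      rw [toContOneCocycle_apply, discreteTopRep_ρ_apply] at h
      exact h
    have hmN : ∀ n : N, (n : G) • m = m := fun n ↦ by
      have h := hm' n
      rw [hfN] at h
      exact (sub_eq_zero.mp h.symm)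
    refine hnp m hmN ?_
    have h := hm' c
    simp only [f, if_neg (not_mem_of_xor hc)] at h
    exact h
  · rw [inflClass_apply, resSubgroupH1_oneCocycleClass, oneCocycleClass_eq_zero_iff]
    refine ⟨0, fun n ↦ ?_⟩
    rw [resCocycle_apply, toContOneCocycle_apply, map_zero, sub_zero]
    exact hfN n
end Generic

/-! ## §2 `E/ℚ`, `K` quadratic: a non-principal anti-invariant point of `E(K)` gives a non-zero class in `ker(res)` -/

section Curve
variable (K : Type) [Field K] [NumberField K] (W : WeierstrassCurve ℚ)

/-- **A Kramer class.**  `K` quadratic (`[K:ℚ] = 2`, `σ ≠ 1`); a point `P ∈ E(K)` with `σP + P = 0` and `P ≠ σQ − Q` for every `Q ∈ E(K)`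
yields a NON-ZERO class in `ker(H¹(ℚ, E) → H¹(K, E_K))` (the inflation of `H¹(K/ℚ, E(K)) ∋ [P] ≠ 0`).
[cite: Kramer1981, proof of Thm. 2] [cite: SerreGaloisCohomology1997, I §5.8] -/
theorem exists_ne_zero_resBaseChange_eq_zero_of_point (h2 : Module.finrank ℚ K = 2) {σ : K ≃ₐ[ℚ] K} (hσ1 : σ ≠ 1)
    (P : (W.baseChange K).toAffine.Point) (hP : Affine.Point.map (W' := W) (σ : K →ₐ[ℚ] K) P + P = 0)
    (hnp : ∀ Q : (W.baseChange K).toAffine.Point, Affine.Point.map (W' := W) (σ : K →ₐ[ℚ] K) Q - Q ≠ P) :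
    ∃ η : W.galH1, η ≠ 0 ∧ resBaseChange W K η = 0 := by
  haveI : Algebra.IsQuadraticExtension ℚ K := ⟨h2⟩
  haveI : IsGalois ℚ K := inferInstance
  haveI hNn : (galRange (K := ℚ) K).Normal := normal_galRange K h2 hσ1
  have hN : IsOpen (galRange (K := ℚ) K : Set (Field.absoluteGaloisGroup ℚ)) := isOpen_galRange K
  have hc := xor_galRange K h2 hσ1
  have hτ : IsLiftOfAut σ (liftAut σ) := isLiftOfAut_liftAut σ
  obtain ⟨a, ha⟩ : ∃ a : geomPoints W, a = (geomPointsEquivBaseChange K W).symm (toGeomPoints (W.baseChange K) P) := ⟨_, rfl⟩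
  have hθa : geomPointsEquivBaseChange K W a = toGeomPoints (W.baseChange K) P := by rw [ha, AddEquiv.apply_symm_apply]
  have haN : ∀ n : galRange (K := ℚ) K, (n : Field.absoluteGaloisGroup ℚ) • a = a := fun n ↦ by
    rw [ha, ← Subgroup.smul_def, ← geomPointsEquivBaseChange_symm_smul, smul_toGeomPoints]
  have hac : a + liftToAbsGal (K := ℚ) K σ • a = 0 := by
    apply (geomPointsEquivBaseChange K W).injective
    rw [map_add, geomPointsEquivBaseChange_conj, hθa, hτ.pointsMap_toGeomPoints, ← map_add, add_comm, hP, map_zero, map_zero]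
  have hnp' : ∀ b : geomPoints W, (∀ n : galRange (K := ℚ) K, (n : Field.absoluteGaloisGroup ℚ) • b = b) →
      a ≠ liftToAbsGal (K := ℚ) K σ • b - b := by
    intro b hb heq
    have hfix : ∀ g : Field.absoluteGaloisGroup K,
        g • geomPointsEquivBaseChange K W b = geomPointsEquivBaseChange K W b := fun g ↦ by
      rw [← geomPointsEquivBaseChange_smul', Subgroup.smul_def, hb]
    obtain ⟨Q, hQ⟩ := exists_toGeomPoints_eq_of_forall_smul_eq (W.baseChange K) hfix
    refine hnp Q (toGeomPoints_injective (W.baseChange K) ?_)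
    rw [map_sub, ← hτ.pointsMap_toGeomPoints, hQ, ← geomPointsEquivBaseChange_conj, ← map_sub, ← heq, hθa]
  obtain ⟨η, hη0, hres⟩ := exists_ne_zero_resSubgroupH1_eq_zero_of_not_principal hN hc haN hac hnp'
  refine ⟨η, hη0, galH1Model_injective K W ?_⟩
  rw [galH1Model_resBaseChange, hres, map_zero]
end Curve

/-! ## §3 The frame package on U_T's habitat with `w(E) = 1`: `Q₀ ∉ 2E(K)`, `τ` trivial on `E(K)/2E(K)`, `m • Q₀` anti-invariant and non-principal -/

section Frame
variable (W : WeierstrassCurve ℚ) [W.IsElliptic] [W.IsGloballyMinimal] [NeZero (W.conductorNorm ℤ)]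
variable (K : Type) [Field K] [NumberField K]

/-- **The frame package.**  On U_T's frame (rev-37 binders of `ShaCardDvdPowAtTwoRT`; only `hndiv` of the `M₀`-clause is used) with
`W.rootNumber = 1` and `τ ∈ Aut(K/ℚ)` non-trivial, there are `Q₀ ∈ E(K)` and an ODD `m` with: `Q₀ ∉ 2E(K)`; `E(K)` has no `2`-torsion;
`τ(m • Q₀) + m • Q₀ = 0`; `τQ − Q ∈ 2E(K)` for EVERY `Q ∈ E(K)` (τ acts trivially on `E(K)/2E(K)`, a group of order `2^(rank E(K)) ≤ 2` by
`mordellWeilRank_baseChange_le_one_onHabitat` and `natCard_quotient_range_zsmul`); and `m • Q₀ ≠ τQ − Q` for every `Q`.  (`2^(n₀) Q₀ = y_K`;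
`m` = order of the torsion point `τQ₀ + Q₀`, Gross 5.3 with `w = 1`.)
[cite: GrossLMS1991, §5 Prop. 5.3] [cite: Kramer1981, proof of Thm. 2] [cite: SilvermanAEC2009, X.§4] -/
theorem exists_framePackage_onHabitat (hQ2 : KolyvaginRelationAtTwo) (hcm : ¬ W.HasCM)
    (hT : Odd W.tamagawaProduct) (v : HeightOneSpectrum (𝓞 ℚ)) (h2v : ((2 : ℕ) : 𝓞 ℚ) ∉ v.asIdeal)
    (hNv : ((W.conductorNorm ℤ : ℕ) : 𝓞 ℚ) ∈ v.asIdeal) (hmult : W.HasMultiplicativeReductionAt v) (hneg : W.Δ < 0)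
    (hIQ : IsImaginaryQuadratic K) (hodd : Odd (NumberField.discr K))
    (h3 : NumberField.discr K ≠ -3) (hHe : SatisfiesHeegnerHypothesis (W.conductorNorm ℤ) K)
    (hsq1 : ¬ IsSquare ((NumberField.discr K : ℚ) * -|W.Δ|)) (hsq2 : ¬ IsSquare ((NumberField.discr K : ℚ) * (-(2 * |W.Δ|))))
    (hρ : ∀ n : ℕ, 0 < n → W.HasSurjectiveModNGaloisRep ((2 : ℤ) ^ n))
    (Dt : ModularParametrizationData W (W.conductorNorm ℤ)) (β : ℤ) (ι : K →+* ℂ) (d₁ : KolyvaginHeegnerData Dt β ι 1) (M₀ : ℕ)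
    (hndiv : ¬ ∃ Q : (W.baseChange (ringClassField K ι 1)).toAffine.Point, ((2 ^ (M₀ + 1) : ℕ) : ℤ) • Q = d₁.derivedPoint)
    (hw : W.rootNumber = 1) {τ : K ≃ₐ[ℚ] K} (hτ : τ ≠ 1) :
    ∃ (Q₀ : (W.baseChange K).toAffine.Point) (m : ℕ), Odd m ∧
      (∀ R : (W.baseChange K).toAffine.Point, (2 : ℤ) • R ≠ Q₀) ∧
      (∀ P : (W.baseChange K).toAffine.Point, (2 : ℤ) • P = 0 → P = 0) ∧
      Affine.Point.map (W' := W) (τ : K →ₐ[ℚ] K) (m • Q₀) + m • Q₀ = 0 ∧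
      (∀ Q : (W.baseChange K).toAffine.Point, ∃ R : (W.baseChange K).toAffine.Point,
        (2 : ℤ) • R = Affine.Point.map (W' := W) (τ : K →ₐ[ℚ] K) Q - Q) ∧
      (∀ Q : (W.baseChange K).toAffine.Point, Affine.Point.map (W' := W) (τ : K →ₐ[ℚ] K) Q - Q ≠ m • Q₀) ∧
      (∀ x y : (W.baseChange K).toAffine.Point, (¬ ∃ S : (W.baseChange K).toAffine.Point, (2 : ℤ) • S = x) →
        (¬ ∃ S : (W.baseChange K).toAffine.Point, (2 : ℤ) • S = y) → ∃ S : (W.baseChange K).toAffine.Point, (2 : ℤ) • S = x - y) := by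
  haveI : Fact (Nat.Prime 2) := ⟨Nat.prime_two⟩
  haveI hell : (W.baseChange K).IsElliptic := inferInstanceAs ((W.map (algebraMap ℚ K)).IsElliptic)
  have h2 : Module.finrank ℚ K = 2 := hIQ.1
  have hs2 : W.HasSurjectiveModNGaloisRep 2 := by simpa using hρ 1 one_pos
  have hττ : τ * τ = 1 := mul_self_eq_one_of_ne_one K hIQ.1 τ hτ
  set τm := WeierstrassCurve.Affine.Point.map (W' := W) (τ : K →ₐ[ℚ] K) with hτm
  have h2tors : ∀ P : (W.baseChange K).toAffine.Point, (2 : ℤ) • P = 0 → P = 0 := fun P hP ↦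
    EigenClassesFinite.forall_zsmul_two_pow_baseChange_eq_zero_of_hasSurjectiveModNGaloisRep_two W K h2 hs2 1 P (by simpa using hP)
  obtain ⟨Ph, hPh, hPhmap⟩ := AdditiveKoly.exists_isHeegnerPoint_map_eq_derivedPoint_one (W := W) (K := K) (Dt := Dt) (β := β)
    (ι := ι) hIQ hHe d₁
  have hP₀ : ∀ Q : (W.baseChange K).toAffine.Point, ((2 ^ (M₀ + 1) : ℕ) : ℤ) • Q ≠ Ph :=
    forall_two_pow_smul_ne_bottom_of_not_dvd_derivedPoint d₁ Ph hPhmap le_rfl hndiv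
  obtain ⟨n₀, Q₀, -, hQ₀, hQ₀2⟩ : ∃ (n₀ : ℕ) (Q₀ : (W.baseChange K).toAffine.Point), n₀ ≤ M₀ ∧ ((2 ^ n₀ : ℕ) : ℤ) • Q₀ = Ph ∧
      ∀ R : (W.baseChange K).toAffine.Point, (2 : ℤ) • R ≠ Q₀ := by
    let Pdiv : ℕ → Prop := fun n ↦ ∃ Q : (W.baseChange K).toAffine.Point, ((2 ^ n : ℕ) : ℤ) • Q = Ph
    have hP0 : Pdiv 0 := ⟨Ph, by rw [pow_zero, Nat.cast_one, one_zsmul]⟩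
    obtain ⟨Q₀, hQ₀⟩ : Pdiv (Nat.findGreatest Pdiv M₀) := Nat.findGreatest_spec (Nat.zero_le M₀) hP0
    refine ⟨Nat.findGreatest Pdiv M₀, Q₀, Nat.findGreatest_le M₀, hQ₀, fun R hR ↦ ?_⟩
    have hP : ((2 ^ (Nat.findGreatest Pdiv M₀ + 1) : ℕ) : ℤ) • R = Ph := by
      rw [pow_succ, Nat.cast_mul, mul_smul]
      have h2R : ((2 : ℕ) : ℤ) • R = Q₀ := by exact_mod_cast hR
      rw [h2R, hQ₀]
    by_cases hlt : Nat.findGreatest Pdiv M₀ + 1 ≤ M₀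
    · exact Nat.findGreatest_is_greatest (Nat.lt_succ_self _) hlt ⟨R, hP⟩
    · have heq : Nat.findGreatest Pdiv M₀ = M₀ := by have := Nat.findGreatest_le (P := Pdiv) M₀; omega
      rw [heq] at hP
      exact hP₀ R hP
  have hgross := X11b.KolyvaginBottom.isOfFinAddOrder_map_sub_neg_rootNumber_smul (W := W) hIQ hHe hPh τ hτ
  rw [hw] at hgross
  have ht : IsOfFinAddOrder (τm Q₀ + Q₀) := by
    refine isOfFinAddOrder_of_zsmul (n := ((2 ^ n₀ : ℕ) : ℤ)) (by positivity) ?_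
    have heq : ((2 ^ n₀ : ℕ) : ℤ) • (τm Q₀ + Q₀) = τm Ph - (-(1 : ℤ)) • Ph := by
      rw [smul_add, ← map_zsmul, hQ₀, neg_smul, one_smul, sub_neg_eq_add]
    rw [heq]
    exact hgross
  have hmodd : Odd (addOrderOf (τm Q₀ + Q₀)) := odd_addOrderOf_of_forall_two_smul_eq_zero (W.baseChange K) h2tors ht
  set m := addOrderOf (τm Q₀ + Q₀) with hm
  have hPanti : τm (m • Q₀) + m • Q₀ = 0 := by
    rw [map_nsmul, ← nsmul_add, hm, addOrderOf_nsmul_eq_zero]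
  set N2 : AddSubgroup (W.baseChange K).toAffine.Point := (zsmulAddGroupHom (α := (W.baseChange K).toAffine.Point) ((2 : ℕ) : ℤ)).range
    with hN2
  have hmemN2 : ∀ x, x ∈ N2 ↔ ∃ y : (W.baseChange K).toAffine.Point, (2 : ℤ) • y = x := fun x ↦ by
    simp only [hN2, AddMonoidHom.mem_range, zsmulAddGroupHom_apply, Nat.cast_ofNat]
  have hrk : (W.baseChange K).mordellWeilRank ≤ 1 :=
    mordellWeilRank_baseChange_le_one_onHabitat hQ2 W hcm hT v h2v hNv hmult hneg K hIQ hodd h3 hHe hsq1 hsq2 hρ Dt β ι d₁ M₀ hndiv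
  have htors1 : Nat.card ((W.baseChange K).toAffine.Point[((2 : ℕ) : ℤ)]) = 1 := by
    rw [Nat.card_eq_one_iff_unique]
    refine ⟨⟨fun x y ↦ Subtype.ext ?_⟩, ⟨0⟩⟩
    have hx : (2 : ℤ) • (x : (W.baseChange K).toAffine.Point) = 0 := by exact_mod_cast mem_torsionBy_iff.mp x.2
    have hy : (2 : ℤ) • (y : (W.baseChange K).toAffine.Point) = 0 := by exact_mod_cast mem_torsionBy_iff.mp y.2
    rw [h2tors _ hx, h2tors _ hy]
  have hcardV : Nat.card ((W.baseChange K).toAffine.Point ⧸ N2) ≤ 2 := by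
    rw [hN2, natCard_quotient_range_zsmul (W.baseChange K) (n := 2) two_ne_zero, htors1, mul_one]
    calc 2 ^ (W.baseChange K).mordellWeilRank ≤ 2 ^ 1 := Nat.pow_le_pow_right (by norm_num) hrk
      _ = 2 := by norm_num
  haveI : Finite ((W.baseChange K).toAffine.Point ⧸ N2) := by
    apply Nat.finite_of_card_ne_zero
    rw [hN2, natCard_quotient_range_zsmul (W.baseChange K) (n := 2) two_ne_zero, htors1, mul_one]
    positivity
  have hV : ∀ x y : (W.baseChange K).toAffine.Point ⧸ N2, x ≠ 0 → y ≠ 0 → x = y := by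
    intro x y hx hy
    by_contra hxy
    haveI : Fintype ((W.baseChange K).toAffine.Point ⧸ N2) := Fintype.ofFinite _
    have h3 : 2 < Fintype.card ((W.baseChange K).toAffine.Point ⧸ N2) :=
      (Fintype.two_lt_card_iff).mpr ⟨x, y, 0, hxy, hx, hy⟩
    rw [← Nat.card_eq_fintype_card] at h3
    omega
  have hττx : ∀ x : K, τ (τ x) = x := fun x ↦ by
    change (τ * τ) x = x
    rw [hττ]
    rfl
  have hττm : ∀ Q : (W.baseChange K).toAffine.Point, τm (τm Q) = Q := fun Q ↦ by
    rcases Q with _ | ⟨x, y, h⟩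
    · rfl
    · exact Affine.Point.some_eq_some_of_eq (hττx x) (hττx y)
  have hτN2 : ∀ Q : (W.baseChange K).toAffine.Point, τm Q - Q ∈ N2 := by
    intro Q
    rw [← QuotientAddGroup.eq_iff_sub_mem]
    by_cases hQ : (QuotientAddGroup.mk Q : (W.baseChange K).toAffine.Point ⧸ N2) = 0
    · have hQmem : Q ∈ N2 := (QuotientAddGroup.eq_zero_iff Q).mp hQ
      obtain ⟨R, hR⟩ := (hmemN2 Q).mp hQmem
      have hτQ : τm Q ∈ N2 := (hmemN2 _).mpr ⟨τm R, by rw [← map_zsmul, hR]⟩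
      rw [hQ, (QuotientAddGroup.eq_zero_iff _).mpr hτQ]
    · refine hV _ _ (fun hτQ ↦ hQ ?_) hQ
      obtain ⟨R, hR⟩ := (hmemN2 _).mp ((QuotientAddGroup.eq_zero_iff _).mp hτQ)
      exact (QuotientAddGroup.eq_zero_iff Q).mpr ((hmemN2 Q).mpr ⟨τm R, by rw [← map_zsmul, hR, hττm]⟩)
  have hnp : ∀ Q : (W.baseChange K).toAffine.Point, τm Q - Q ≠ m • Q₀ := by
    intro Q hQ
    obtain ⟨R, hR⟩ := (hmemN2 _).mp (hQ ▸ hτN2 Q)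
    obtain ⟨k, hk⟩ := hmodd
    refine hQ₀2 (R - (k : ℤ) • Q₀) ?_
    rw [smul_sub, hR, hk, smul_smul, ← natCast_zsmul Q₀ (2 * k + 1), ← sub_smul]
    push_cast
    rw [show (2 * (k : ℤ) + 1 - 2 * k) = 1 by ring, one_smul]
  have hV2 : ∀ x y : (W.baseChange K).toAffine.Point, (¬ ∃ S : (W.baseChange K).toAffine.Point, (2 : ℤ) • S = x) →
      (¬ ∃ S : (W.baseChange K).toAffine.Point, (2 : ℤ) • S = y) → ∃ S : (W.baseChange K).toAffine.Point, (2 : ℤ) • S = x - y := by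
    intro x y hx hy
    have hx' : (QuotientAddGroup.mk x : (W.baseChange K).toAffine.Point ⧸ N2) ≠ 0 := fun h ↦
      hx ((hmemN2 x).mp ((QuotientAddGroup.eq_zero_iff x).mp h))
    have hy' : (QuotientAddGroup.mk y : (W.baseChange K).toAffine.Point ⧸ N2) ≠ 0 := fun h ↦
      hy ((hmemN2 y).mp ((QuotientAddGroup.eq_zero_iff y).mp h))
    exact (hmemN2 _).mp ((QuotientAddGroup.eq_iff_sub_mem).mp (hV _ _ hx' hy'))
  exact ⟨Q₀, m, hmodd, hQ₀2, h2tors, hPanti, fun Q ↦ (hmemN2 _).mp (hτN2 Q), hnp, hV2⟩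

/-- **The Kramer class of the generator is non-zero on U_T's frame** (with `W.rootNumber = 1`): `ker(resBaseChange W K) ≠ 0`
(§2 applied to `P = m • Q₀` of the frame package). [cite: Kramer1981, proof of Thm. 2] [cite: GrossLMS1991, §5 Prop. 5.3] -/
theorem exists_ne_zero_resBaseChange_eq_zero_onHabitat (hQ2 : KolyvaginRelationAtTwo) (hcm : ¬ W.HasCM)
    (hT : Odd W.tamagawaProduct) (v : HeightOneSpectrum (𝓞 ℚ)) (h2v : ((2 : ℕ) : 𝓞 ℚ) ∉ v.asIdeal)
    (hNv : ((W.conductorNorm ℤ : ℕ) : 𝓞 ℚ) ∈ v.asIdeal) (hmult : W.HasMultiplicativeReductionAt v) (hneg : W.Δ < 0)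
    (hIQ : IsImaginaryQuadratic K) (hodd : Odd (NumberField.discr K))
    (h3 : NumberField.discr K ≠ -3) (hHe : SatisfiesHeegnerHypothesis (W.conductorNorm ℤ) K)
    (hsq1 : ¬ IsSquare ((NumberField.discr K : ℚ) * -|W.Δ|)) (hsq2 : ¬ IsSquare ((NumberField.discr K : ℚ) * (-(2 * |W.Δ|))))
    (hρ : ∀ n : ℕ, 0 < n → W.HasSurjectiveModNGaloisRep ((2 : ℤ) ^ n))
    (Dt : ModularParametrizationData W (W.conductorNorm ℤ)) (β : ℤ) (ι : K →+* ℂ) (d₁ : KolyvaginHeegnerData Dt β ι 1) (M₀ : ℕ)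
    (hndiv : ¬ ∃ Q : (W.baseChange (ringClassField K ι 1)).toAffine.Point, ((2 ^ (M₀ + 1) : ℕ) : ℤ) • Q = d₁.derivedPoint)
    (hw : W.rootNumber = 1) :
    ∃ η : W.galH1, η ≠ 0 ∧ resBaseChange W K η = 0 := by
  obtain ⟨τ, hτ, -⟩ := Literature.NumberTheory.EllipticCurves.exists_conj_of_isImaginaryQuadratic (K := K) hIQ
  obtain ⟨Q₀, m, -, -, -, hPanti, -, hnp, -⟩ := exists_framePackage_onHabitat W K hQ2 hcm hT v h2v hNv hmult hneg hIQ hodd h3 hHe hsq1 hsq2 hρ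
    Dt β ι d₁ M₀ hndiv hw hτ
  exact exists_ne_zero_resBaseChange_eq_zero_of_point K W hIQ.1 hτ (m • Q₀) hPanti hnp

/-- **τ-fixed points of `E(K)` are halvable by τ-fixed points, on U_T's frame** (with `W.rootNumber = 1`): if `τd = d` then `d = S + S` with
`τS = S`.  (`E(K)/2E(K) = {0, [Q₀]}`; the class `[Q₀]` is NOT τ-fixed-representable: `d = Q₀ + 2S`, `τd = d` would give
`m • Q₀ = τ(mS′) − mS′`, against the frame package; so `d ∈ 2E(K)`, `d = 2S`, and `2(τS − S) = 0` forces `τS = S`.)  This is the hypothesis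
`Ĥ⁰(C₂, E(K)) ⊇ E(ℚ)`-form needed by `exists_resBaseChange_eq_of_conjH1Points_eq_of_twoDivisible`. [cite: GrossLMS1991, §5 Prop. 5.3]
[cite: SerreGaloisCohomology1997, I §2.6 (b)] -/
theorem exists_fixed_half_onHabitat (hQ2 : KolyvaginRelationAtTwo) (hcm : ¬ W.HasCM)
    (hT : Odd W.tamagawaProduct) (v : HeightOneSpectrum (𝓞 ℚ)) (h2v : ((2 : ℕ) : 𝓞 ℚ) ∉ v.asIdeal)
    (hNv : ((W.conductorNorm ℤ : ℕ) : 𝓞 ℚ) ∈ v.asIdeal) (hmult : W.HasMultiplicativeReductionAt v) (hneg : W.Δ < 0)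
    (hIQ : IsImaginaryQuadratic K) (hodd : Odd (NumberField.discr K))
    (h3 : NumberField.discr K ≠ -3) (hHe : SatisfiesHeegnerHypothesis (W.conductorNorm ℤ) K)
    (hsq1 : ¬ IsSquare ((NumberField.discr K : ℚ) * -|W.Δ|)) (hsq2 : ¬ IsSquare ((NumberField.discr K : ℚ) * (-(2 * |W.Δ|))))
    (hρ : ∀ n : ℕ, 0 < n → W.HasSurjectiveModNGaloisRep ((2 : ℤ) ^ n))
    (Dt : ModularParametrizationData W (W.conductorNorm ℤ)) (β : ℤ) (ι : K →+* ℂ) (d₁ : KolyvaginHeegnerData Dt β ι 1) (M₀ : ℕ)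
    (hndiv : ¬ ∃ Q : (W.baseChange (ringClassField K ι 1)).toAffine.Point, ((2 ^ (M₀ + 1) : ℕ) : ℤ) • Q = d₁.derivedPoint)
    (hw : W.rootNumber = 1) {τ : K ≃ₐ[ℚ] K} (hτ : τ ≠ 1) (d : (W.baseChange K).toAffine.Point)
    (hd : Affine.Point.map (W' := W) (τ : K →ₐ[ℚ] K) d = d) :
    ∃ S : (W.baseChange K).toAffine.Point, Affine.Point.map (W' := W) (τ : K →ₐ[ℚ] K) S = S ∧ d = S + S := by
  obtain ⟨Q₀, m, -, hQ₀2, h2tors, hPanti, -, hnp, hV2⟩ := exists_framePackage_onHabitat W K hQ2 hcm hT v h2v hNv hmult hneg hIQ hodd h3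
    hHe hsq1 hsq2 hρ Dt β ι d₁ M₀ hndiv hw hτ
  set τm := WeierstrassCurve.Affine.Point.map (W' := W) (τ : K →ₐ[ℚ] K) with hτm
  by_cases hdN : ∃ S : (W.baseChange K).toAffine.Point, (2 : ℤ) • S = d
  · -- `d = 2S`, and `2 (τS − S) = τd − d = 0` forces `τS = S`
    obtain ⟨S, hS⟩ := hdN
    refine ⟨S, ?_, by rw [← two_zsmul, hS]⟩
    have h0 : (2 : ℤ) • (τm S - S) = 0 := by rw [smul_sub, ← map_zsmul, hS, hd, sub_self]
    exact sub_eq_zero.mp (h2tors _ h0)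
  · -- `d ∉ 2E(K)`: then `d − Q₀ = 2S`, and `τd = d` would make `m • Q₀ = τ(mS) − mS`
    exfalso
    obtain ⟨S, hS⟩ := hV2 d Q₀ hdN (fun ⟨S, hS⟩ ↦ hQ₀2 S hS)
    refine hnp (m • S) (sub_eq_zero.mp (h2tors _ ?_))
    have hPanti' : m • τm Q₀ = -(m • Q₀) := by
      rw [← map_nsmul]
      exact eq_neg_of_add_eq_zero_left hPanti
    have h2S : (2 : ℤ) • τm S = d - τm Q₀ := by rw [← map_zsmul, hS, map_sub, hd]
    rw [smul_sub, smul_sub, map_nsmul, smul_comm (2 : ℤ) m (τm S), h2S, smul_comm (2 : ℤ) m S, hS, smul_sub, smul_sub,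
      hPanti', two_zsmul]
    abel
end Frame

/-! ## §4 On U_T's frame: τ-invariant classes of `H¹(K, E_K)` are restrictions from `H¹(ℚ, E)` -/

section FrameDescent
variable (W : WeierstrassCurve ℚ) [W.IsElliptic] [W.IsGloballyMinimal] [NeZero (W.conductorNorm ℤ)]
variable (K : Type) [Field K] [NumberField K]

/-- **INVARIANT CLASSES ARE RESTRICTIONS ON U_T's FRAME** (with `W.rootNumber = 1`): for the non-trivial `σ ∈ Aut(K/ℚ)` and its chosen lift
`τ = liftAut σ`, every `s ∈ H¹(K, E_K)` with `τ_* s = s` is `res b` for some `b ∈ H¹(ℚ, E)` — `exists_resBaseChange_eq_of_conjH1Points_eq_of_twoDivisible`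
fed with §3's halving of σ-fixed points (the transgression obstruction `E(ℚ)/N E(K)` vanishes).  Consequently every τ-fixed class of `Ш(E/K)[2^∞]`
has a τ-INVARIANT Selmer lift (the ν-bit of LINE 19's SANDWICH′, memo §6c). [cite: SerreGaloisCohomology1997, I §2.6 (b)] [cite: GrossLMS1991, §5 (5.1)–(5.3)] -/
theorem exists_resBaseChange_eq_of_conjH1Points_eq_onHabitat (hQ2 : KolyvaginRelationAtTwo) (hcm : ¬ W.HasCM)
    (hT : Odd W.tamagawaProduct) (v : HeightOneSpectrum (𝓞 ℚ)) (h2v : ((2 : ℕ) : 𝓞 ℚ) ∉ v.asIdeal)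
    (hNv : ((W.conductorNorm ℤ : ℕ) : 𝓞 ℚ) ∈ v.asIdeal) (hmult : W.HasMultiplicativeReductionAt v) (hneg : W.Δ < 0)
    (hIQ : IsImaginaryQuadratic K) (hodd : Odd (NumberField.discr K))
    (h3 : NumberField.discr K ≠ -3) (hHe : SatisfiesHeegnerHypothesis (W.conductorNorm ℤ) K)
    (hsq1 : ¬ IsSquare ((NumberField.discr K : ℚ) * -|W.Δ|)) (hsq2 : ¬ IsSquare ((NumberField.discr K : ℚ) * (-(2 * |W.Δ|))))
    (hρ : ∀ n : ℕ, 0 < n → W.HasSurjectiveModNGaloisRep ((2 : ℤ) ^ n))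
    (Dt : ModularParametrizationData W (W.conductorNorm ℤ)) (β : ℤ) (ι : K →+* ℂ) (d₁ : KolyvaginHeegnerData Dt β ι 1) (M₀ : ℕ)
    (hndiv : ¬ ∃ Q : (W.baseChange (ringClassField K ι 1)).toAffine.Point, ((2 ^ (M₀ + 1) : ℕ) : ℤ) • Q = d₁.derivedPoint)
    (hw : W.rootNumber = 1) {σ : K ≃ₐ[ℚ] K} (hσ1 : σ ≠ 1)
    {s : (W.baseChange K).galH1} (hs : (isLiftOfAut_liftAut σ).conjH1Points W s = s) :
    ∃ b : W.galH1, resBaseChange W K b = s := by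
  have h2 : Module.finrank ℚ K = 2 := hIQ.1
  haveI : Algebra.IsQuadraticExtension ℚ K := ⟨h2⟩
  haveI : IsGalois ℚ K := inferInstance
  haveI hNn : (galRange (K := ℚ) K).Normal := normal_galRange K h2 hσ1
  have hc := xor_galRange K h2 hσ1
  have hτ : IsLiftOfAut σ (liftAut σ) := isLiftOfAut_liftAut σ
  refine exists_resBaseChange_eq_of_conjH1Points_eq_of_twoDivisible K W h2 hσ1 (fun P hP ↦ ?_) hs
  have hfix : ∀ g : Field.absoluteGaloisGroup K,
      g • geomPointsEquivBaseChange K W P = geomPointsEquivBaseChange K W P := fun g ↦ by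
    rw [← geomPointsEquivBaseChange_smul', Subgroup.smul_def, hP]
  obtain ⟨d, hd⟩ := exists_toGeomPoints_eq_of_forall_smul_eq (W.baseChange K) hfix
  have hσd : Affine.Point.map (W' := W) (σ : K →ₐ[ℚ] K) d = d := by
    apply toGeomPoints_injective (W.baseChange K)
    rw [← hτ.pointsMap_toGeomPoints, hd, ← geomPointsEquivBaseChange_conj, hP]
  obtain ⟨S, hS, hdS⟩ := exists_fixed_half_onHabitat W K hQ2 hcm hT v h2v hNv hmult hneg hIQ hodd h3 hHe hsq1 hsq2 hρ Dt β ι d₁ M₀ hndiv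
    hw hσ1 d hσd
  refine ⟨(geomPointsEquivBaseChange K W).symm (toGeomPoints (W.baseChange K) S), fun g ↦ ?_, ?_⟩
  · -- fixed by `N = galRange K` and by `c = liftToAbsGal σ`, hence by `G = N ⊔ N c`
    have hN' : ∀ n : galRange (K := ℚ) K,
        (n : Field.absoluteGaloisGroup ℚ) • (geomPointsEquivBaseChange K W).symm (toGeomPoints (W.baseChange K) S) =
          (geomPointsEquivBaseChange K W).symm (toGeomPoints (W.baseChange K) S) := fun n ↦ by
      rw [← Subgroup.smul_def, ← geomPointsEquivBaseChange_symm_smul, smul_toGeomPoints]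
    have hc' : liftToAbsGal (K := ℚ) K σ • (geomPointsEquivBaseChange K W).symm (toGeomPoints (W.baseChange K) S) =
        (geomPointsEquivBaseChange K W).symm (toGeomPoints (W.baseChange K) S) := by
      apply (geomPointsEquivBaseChange K W).injective
      rw [geomPointsEquivBaseChange_conj, AddEquiv.apply_symm_apply, hτ.pointsMap_toGeomPoints, hS]
    rcases exists_eq_or_eq_mul hc g with ⟨n, rfl⟩ | ⟨n, rfl⟩
    · exact hN' n
    · rw [mul_smul, hc', hN' n]
  · apply (geomPointsEquivBaseChange K W).injective
    rw [map_add, AddEquiv.apply_symm_apply, ← hd, hdS, map_add]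
end FrameDescent

end Summit.BirchSwinnertonDyer.BirchSwinnertonDyer.Theorems.GenusExact.PlusDescent

end
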